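import Mathlib.Data.ZMod.Basic
import Mathlib.Data.Finset.Powerset
import Mathlib.Data.Finset.Card
import Mathlib.Data.Fintype.Prod
import Mathlib.Data.Fintype.Powerset
import HarnessLib

/-!
# The product `B₀ × B₁` of two Galois-conjugate, non-isogenous simple CM threefolds of a NON-Galois sextic CM field
# `K = k·F₀`: every Galois-balanced weight is a divisor weight or a `k`-Weil weight — a kernel census

COR-CM (cell `pub-hodgecm2`), seat b30 gen 14 (2026-08-21); count-neutral.  Companion of
`Census/DihedralSexticFace.lean` (same field, the PerL-shaped core `B₀ × B₁ × B₂ × E`, which DOES carry Hodge classes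
outside the divisor + quadratic-Weil span) and the combinatorial input of the seat's theorem file
`CorCM/DihedralSexticPairHodgeOfMarkman.lean` (the Hodge conjecture for `B₀ × B₁` modulo Markman's fourfold theorem).
A finite, kernel-decided computation: no named fact, no geometry, no `sorry`.

MODEL.  `K = k·F₀`, `k` imaginary quadratic, `F₀` a non-cyclic totally real cubic; `Gal(K^{gal}/ℚ) = S₃ × C₂ =
⟨r, s⟩ × ⟨c⟩` acts on `Hom(K, ℚ̄) = {(i, b)}` (`i ∈ ℤ/3` the real place of `F₀`, `b` the restriction to `k`, `true` =
a fixed `τ : k → ℂ`) by `r : i ↦ i + 1`, `s : i ↦ -i`, `c : b ↦ ¬b`.  Points of `Y = B₀ × B₁`: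
`Pt = (slot m, place i, sign b)`, twelve of them; CM type `Φ_Y`: slot `m` has sign `true` exactly at place `m`
(`B₀ = (+,−,−)`, `B₁ = (−,+,−)`: two of the three primitive sign vectors with one `+`, conjugate under `r`, not
related by `Aut(K) = {1, c}` — non-isogenous simple CM threefolds).  The `k`-WEIL weights of `Y` for the
`k`-structure `(ι₀ ∘ i, ι₁ ∘ ī)` of signature `(3,3)`: `W₊ = {(0,i,+)} ⊔ {(1,i,−)}` and `W₋ = c·W₊`.

DICTIONARY (formalised in `CorCM/DihedralSexticPairHodgeOfMarkman.lean`, cited here).  Pohlmann's theorem for the CM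
algebra `K × K` [cite: GaoUllmo2025, Thm 3.1] [cite: Pohlmann1968, Thm 1]: `Bᵖ(Y) ⊗ ℂ` is the sum of the weight
lines `H^{2p}(Y)_S` over the `2p`-sets `S` with `#{x ∈ S : g·x ∈ Φ_Y} = #{x ∈ S : g·x ∉ Φ_Y}` for all `g`; a
conjugation-stable `S` is a disjoint union of pairs `{x, c·x}` and indexes a monomial in divisor classes
[cite: Gordon1999HodgeAVSurvey, 9.2.2]; `W_±` index the two lines of `W_k(Y) ⊗ ℂ` [cite: Deligne1982HodgeCycles, §5 (c)].

RESULT (kernel): **every balanced weight of `Y`, of any size, is conjugation-stable or equal to `W₊` or `W₋`**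
(`balanced_classification`); there are `66 = 1+6+15+22+15+6+1` balanced weights (`card_balanced`), so
`B•(B₀ × B₁) = D• + W_k`: by divisors and the TWO `k`-Weil `(3,3)`-classes (algebraic modulo Markman, seat file
`CorCM/CMThreefoldPairWeilClassesOfMarkman.lean` p249751/p250027) the whole Hodge ring is generated.  The
transposition `s` is needed: for the index-`2` subgroup `⟨r, c⟩ ≅ C₆` alone the balanced counts are
`1/12/51/88/51/12/1` (`card_balanced_cyclic`).

## References
* [Pohlmann1968] H. Pohlmann, Ann. of Math. 88 (1968), Thm 1.  [GaoUllmo2025] Z. Gao, E. Ullmo, J. Inst. Math. Jussieu 25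
  (2025), Thm 3.1.  [Gordon1999HodgeAVSurvey] B. B. Gordon, CRM Monogr. 10 (1999), 9.2.2.
* [Deligne1982HodgeCycles] P. Deligne (notes by J. S. Milne), LNM 900 (1982), §5 (c).
* [Markman2025SurveySecant] E. Markman, arXiv:2509.23403, Thm. 1.2.

## Provenance
Exact python first (seat folder `work/scratch/pair_census.py`, < 1 s): same counts, `0` exceptions.
-/

namespace Summit.HodgeConjecture.CorCM.Census.DihedralSexticPair

open Finset

/-! ### The model -/

/-- Points of `Y = B₀ × B₁`: `(slot m, place i, sign b)`. [cite: GaoUllmo2025, §2.1] -/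
abbrev Pt : Type := Fin 2 × ZMod 3 × Bool

/-- The element `(rʲ sᶠ, cᵈ)` of `S₃ × C₂` (`d = false` means: apply `c`): places `i ↦ ±i + j`, signs flipped by `c`;
the slot is untouched (diagonal action on `Hom(K × K, ℚ̄) = Hom(K, ℚ̄) ⊔ Hom(K, ℚ̄)`). [folklore] -/
def act (j : ZMod 3) (f : Bool) (d : Bool) : Pt → Pt
  | (m, i, b) => (m, (if f then -i else i) + j, if d then b else !b)

/-- Unfolding of `act` on a point. [folklore] -/
theorem act_apply (j : ZMod 3) (f d : Bool) (m : Fin 2) (i : ZMod 3) (b : Bool) :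
    act j f d (m, i, b) = (m, (if f then -i else i) + j, if d then b else !b) := rfl

/-- The CM type of `Y = B₀ × B₁`: slot `m` has sign `true` exactly at place `m`. [folklore] -/
def phi : Finset Pt :=
  {((0 : Fin 2), (0 : ZMod 3), true), (0, 1, false), (0, 2, false), (1, 0, false), (1, 1, true), (1, 2, false)}

/-- The `k`-Weil weight `W₊`: the `τ`-fibre of slot `0` and the `τ̄`-fibre of slot `1` (the `+i√d`-eigenspace of the
`k`-structure `(ι₀(iδ), ι₁(īδ))`, six eigenlines of `H¹(Y)`; `⋀⁶` = one line of `W_k ⊗ ℂ`). [cite: Deligne1982HodgeCycles, §5 (c)] -/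
def weilPlus : Finset Pt :=
  {((0 : Fin 2), (0 : ZMod 3), true), (0, 1, true), (0, 2, true), (1, 0, false), (1, 1, false), (1, 2, false)}

/-- The `k`-Weil weight `W₋ = c·W₊` (the `-i√d`-eigenspace). [cite: Deligne1982HodgeCycles, §5 (c)] -/
def weilMinus : Finset Pt :=
  {((0 : Fin 2), (0 : ZMod 3), false), (0, 1, false), (0, 2, false), (1, 0, true), (1, 1, true), (1, 2, true)}

/-- Pohlmann's condition [cite: GaoUllmo2025, Thm 3.1 eq. (3.2)] for all twelve `g ∈ S₃ × C₂`:
`#{x ∈ S | g·x ∈ Φ_Y} = #{x ∈ S | g·x ∉ Φ_Y}`. -/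
def balanced (S : Finset Pt) : Bool :=
  decide (∀ g : ZMod 3 × Bool × Bool,
    (S.filter fun x => act g.1 g.2.1 g.2.2 x ∈ phi).card = (S.filter fun x => act g.1 g.2.1 g.2.2 x ∉ phi).card)

/-- `S` is stable under complex conjugation `c = act 0 false false` (then it is a disjoint union of pairs `{x, c·x}`,
the weight of a divisor monomial). [cite: Gordon1999HodgeAVSurvey, 9.2.2] -/
def conjStable (S : Finset Pt) : Bool := decide (∀ x ∈ S, act 0 false false x ∈ S)

/-! ### Sanity of the model -/

set_option maxRecDepth 8000 in
/-- `Φ_Y` is a CM type slot by slot (exactly one of `x`, `c·x`), `c` is a fixed-point-free involution. [folklore] -/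
theorem isCMType_phi : (∀ x : Pt, (x ∈ phi ↔ act 0 false false x ∉ phi)) ∧
    (∀ x : Pt, act 0 false false (act 0 false false x) = x) ∧ (∀ x : Pt, act 0 false false x ≠ x) := by
  refine ⟨by decide +kernel, by decide +kernel, by decide +kernel⟩

set_option maxRecDepth 8000 in
set_option maxHeartbeats 4000000 in
/-- The twelve maps `act j f d` form a faithful `S₃ × C₂`: `r = act 1 false true` has order `3`, `s = act 0 true true` and
`c = act 0 false false` are involutions, `s r s = r⁻¹`, `c` central, the maps pairwise distinct; and the normal form
`act j f d = rʲ ∘ sᶠ ∘ c^{¬d}` used by the frame transfer: `act j f true ∘ c = act j f false`,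
`act j false true ∘ s = act j true true`, `r ∘ act j f true = act (j+1) f true`. [folklore] -/
theorem act_relations : (∀ x : Pt, act 1 false true (act 1 false true (act 1 false true x)) = x) ∧
    (∀ x : Pt, act 0 true true (act 0 true true x) = x) ∧
    (∀ x : Pt, act 0 true true (act 1 false true (act 0 true true x)) = act 2 false true x) ∧
    (∀ x : Pt, act 0 false false (act 1 false true x) = act 1 false true (act 0 false false x)) ∧
    (∀ x : Pt, act 0 false false (act 0 true true x) = act 0 true true (act 0 false false x)) ∧
    (∀ g g' : ZMod 3 × Bool × Bool, (∀ x : Pt, act g.1 g.2.1 g.2.2 x = act g'.1 g'.2.1 g'.2.2 x) → g = g') ∧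
    (∀ (j : ZMod 3) (f : Bool) (x : Pt), act j f true (act 0 false false x) = act j f false x) ∧
    (∀ (j : ZMod 3) (x : Pt), act j false true (act 0 true true x) = act j true true x) ∧
    (∀ (j : ZMod 3) (f : Bool) (x : Pt), act 1 false true (act j f true x) = act (j + 1) f true x) ∧
    (∀ x : Pt, act 0 false true x = x) := by
  refine ⟨by decide +kernel, by decide +kernel, by decide +kernel, by decide +kernel, by decide +kernel,
    by decide +kernel, by decide +kernel, by decide +kernel, by decide +kernel, by decide +kernel⟩

set_option maxRecDepth 8000 in
/-- Uniform membership test for `Φ_Y`: `(m, i, b) ∈ Φ_Y ↔ b = [i = m]` (comparing residues `i.val = m.val`). [folklore] -/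
theorem mem_phi_iff : ∀ x : Pt, x ∈ phi ↔ x.2.2 = decide (x.2.1.val = x.1.val) := by decide +kernel

set_option maxRecDepth 8000 in
/-- The slots: `B₀` has sign `true` exactly at place `0`, `B₁` exactly at place `1`; `r` carries the type of slot `0` to
the sign vector `(−,+,−)` of slot `1` (Galois-conjugate threefolds), and the two sign vectors are neither equal nor
opposite (not related by `Aut(K) = {1, c}`: non-isogenous). [folklore] -/
theorem slots : (∀ (i : ZMod 3) (b : Bool), (((0 : Fin 2), i, b) ∈ phi ↔ b = decide (i = 0))) ∧
    (∀ (i : ZMod 3) (b : Bool), (((1 : Fin 2), i, b) ∈ phi ↔ b = decide (i = 1))) ∧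
    (∀ (i : ZMod 3) (b : Bool), (((0 : Fin 2), i, b) ∈ phi ↔ ((1 : Fin 2), i + 1, b) ∈ phi)) ∧
    (∃ i : ZMod 3, ((0 : Fin 2), i, true) ∈ phi ∧ ((1 : Fin 2), i, true) ∉ phi) ∧
    (∃ i : ZMod 3, ((0 : Fin 2), i, true) ∉ phi ∧ ((1 : Fin 2), i, true) ∉ phi) := by
  refine ⟨by decide +kernel, by decide +kernel, by decide +kernel, by decide +kernel, by decide +kernel⟩

set_option maxRecDepth 8000 in
/-- The Weil weights: `W₊` = (sign `true` on slot `0`) ⊔ (sign `false` on slot `1`), `W₋ = c·W₊`, both of size `6` with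
three points in `Φ_Y` (Hodge type `(3,3)`), neither conjugation-stable, and `W₊ ∩ W₋ = ∅`. [cite: Deligne1982HodgeCycles, §5 (c)] -/
theorem weil_structure : (∀ x : Pt, x ∈ weilPlus ↔ x.2.2 = decide (x.1 = 0)) ∧
    (∀ x : Pt, x ∈ weilMinus ↔ x.2.2 = !decide (x.1 = 0)) ∧
    (∀ x : Pt, x ∈ weilMinus ↔ act 0 false false x ∈ weilPlus) ∧
    weilPlus.card = 6 ∧ weilMinus.card = 6 ∧ (weilPlus.filter fun x => x ∈ phi).card = 3 ∧
    (weilMinus.filter fun x => x ∈ phi).card = 3 ∧ conjStable weilPlus = false ∧ conjStable weilMinus = false ∧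
    Disjoint weilPlus weilMinus := by
  refine ⟨by decide +kernel, by decide +kernel, by decide +kernel, by decide +kernel, by decide +kernel,
    by decide +kernel, by decide +kernel, by decide +kernel, by decide +kernel, by decide +kernel⟩

/-! ### The classification of balanced weights -/

set_option maxRecDepth 8000 in
set_option maxHeartbeats 4000000 in
/-- **Every Galois-balanced weight of `Y = B₀ × B₁` is conjugation-stable or one of the two `k`-Weil weights.**
[cite: GaoUllmo2025, Thm 3.1] [cite: Gordon1999HodgeAVSurvey, 9.2.2] [cite: Deligne1982HodgeCycles, §5 (c)] -/
theorem balanced_classification :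
    ∀ S : Finset Pt, balanced S = true → conjStable S = true ∨ S = weilPlus ∨ S = weilMinus := by
  decide +kernel

set_option maxRecDepth 8000 in
set_option maxHeartbeats 4000000 in
/-- Conversely the two Weil weights ARE balanced (and every conjugation-stable weight is, pair by pair). [cite: GaoUllmo2025, Thm 3.1] -/
theorem balanced_weil : balanced weilPlus = true ∧ balanced weilMinus = true := by
  refine ⟨by decide +kernel, by decide +kernel⟩

set_option maxRecDepth 8000 in
set_option maxHeartbeats 4000000 in
/-- **The census**: `66 = 1 + 6 + 15 + 22 + 15 + 6 + 1` balanced weights (sizes `0, 2, …, 12`) — `dim B³(B₀ × B₁) = 22 =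
20` divisor monomials `+ 2` Weil lines, `dim Bᵖ = dim Dᵖ` for `p ≠ 3`. [cite: GaoUllmo2025, Thm 3.1] -/
theorem card_balanced : ((univ : Finset (Finset Pt)).filter fun S => balanced S = true).card = 66 ∧
    (((univ : Finset Pt).powersetCard 6).filter fun S => balanced S = true).card = 22 ∧
    (((univ : Finset Pt).powersetCard 6).filter fun S => balanced S = true ∧ conjStable S = true).card = 20 ∧
    (((univ : Finset Pt).powersetCard 4).filter fun S => balanced S = true).card = 15 ∧
    (((univ : Finset Pt).powersetCard 2).filter fun S => balanced S = true).card = 6 := by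
  refine ⟨by decide +kernel, by decide +kernel, by decide +kernel, by decide +kernel, by decide +kernel⟩

/-- Pohlmann's condition for the index-two subgroup `⟨r, c⟩ ≅ C₆` only (no transposition). [folklore] -/
def balancedCyclic (S : Finset Pt) : Bool :=
  decide (∀ g : ZMod 3 × Bool,
    (S.filter fun x => act g.1 false g.2 x ∈ phi).card = (S.filter fun x => act g.1 false g.2 x ∉ phi).card)

set_option maxRecDepth 8000 in
set_option maxHeartbeats 4000000 in
/-- **The transposition is needed**: for `⟨r, c⟩ ≅ C₆` alone there are `88` balanced `6`-weights (not `22`) and `51`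
balanced `4`-weights (not `15`) — e.g. `{(0,0,+), (1,1,−)}` is `C₆`-balanced, not `S₃ × C₂`-balanced. [folklore] -/
theorem card_balanced_cyclic :
    (((univ : Finset Pt).powersetCard 6).filter fun S => balancedCyclic S = true).card = 88 ∧
    (((univ : Finset Pt).powersetCard 4).filter fun S => balancedCyclic S = true).card = 51 ∧
    balancedCyclic {((0 : Fin 2), (0 : ZMod 3), true), (1, 1, false)} = true ∧
    balanced {((0 : Fin 2), (0 : ZMod 3), true), (1, 1, false)} = false := by
  refine ⟨by decide +kernel, by decide +kernel, by decide +kernel, by decide +kernel⟩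

end Summit.HodgeConjecture.CorCM.Census.DihedralSexticPair
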